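import Literature.NumberTheory.EllipticCurves.HeegnerPointsOfConductorGaloisConj
import Literature.NumberTheory.EllipticCurves.HeegnerPointsOfConductorOneData
import Literature.NumberTheory.EllipticCurves.HeegnerPointsShimuraReduction
import Literature.NumberTheory.EllipticCurves.HeegnerPointsRationalityProofs
import Literature.NumberTheory.EllipticCurves.HeegnerPointsClassNumberProofs
import Literature.NumberTheory.EllipticCurves.RingClassFieldGenerator
import Literature.NumberTheory.EllipticCurves.RingClassFieldDegree
import Literature.NumberTheory.EllipticCurves.HeckeNeighbourTransport
import Literature.NumberTheory.QuadraticFields.DedekindZetaReducedForms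
import HarnessLib

/-!
# Shimura reciprocity for `y(1)`: `Gal(K_1/K)` carries `φ(x_1)` bijectively onto the `h_K` Heegner
# points `φ(τ_Q)` (Darmon 2004, Thm. 3.7; Gross 1991, §1/§4) — DISCHARGED

H. Darmon, *Rational Points on Modular Elliptic Curves*, CBMS 101 (2004), Thm. 3.7 (PDF p. 44):
*"If `τ` belongs to `CM(𝒪)` and `α` belongs to `Pic(𝒪)`, then `Φ_N(α ⋆ τ) = rec(α⁻¹) Φ_N(τ)`"*, with
§3.7 (PDF p. 49) *"`P_K = Trace_{H_1/K}(P_1)`"*; B. H. Gross, LMS LNS 153 (1991), §1 *"`y_K = Tr_{K_1/K}(y_1)`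
… obtained by adding `y_1` to its conjugates"* and §4 *"`P_1 = Σ_{σ ∈ S} σ y_1 = Tr_{K_1/K}(y_1) = y_K`"*;
B. H. Gross, *Heegner points on `X₀(N)`* (1984), §I.1 (`Pic(𝒪_K)` acts simply transitively on the
Heegner points `(𝒪_K, 𝔫, [𝔞])`). The tree records the consequence "the conjugates `s • y(1)`,
`s ∈ S = Gal(K[1]/K)`, are, bijectively, the `φ(τ_Q)`, `Q ∈ H.reps`" as the named fact
`Literature.NumberTheory.EllipticCurves.heegnerPointOfConductor_one_galoisConj N W K`
(`HeegnerPointsOfConductorGaloisConj.lean`; 136 consumer files, all at `K : Type`), documented *"Not provable in the tree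
today (Artin map and main theorem of CM not in Mathlib)"*. It IS provable from what the tree already
proves; this file does it at `K : Type` (theorems only; no definition, no named fact):

* for `s ∈ S` (`= 𝒢_1 = Gal(K[1]/K)`, `KolyvaginHeegnerData.mem_S_iff`) extend `s` to `σ_s ∈ Aut(ℂ)`
  (`Complex.exists_ringEquiv_apply_eq_of_subfield`, `K[1]` countable); `σ_s` fixes `ι(K)`, hence `√d_K`
  (`apply_sqrtDisc_discr_eq`);
* Shimura reciprocity in transport form (`exists_levelTransport_of_apply_sqrtDisc_eq`, Darmon Thm. 3.7 /
  Gross 1984 §I.1) moves the level-`N` structure of `x(1) = τ_{Q_1}`, `Q_1 = ((β² − d_K)/4, β, 1)`, to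
  that of a Heegner form with the same residue `β`, hence (`HeegnerDatum.exists_isGamma0Equiv`,
  `LevelTransport.of_gamma0_smul_eq_right`) to that of a unique representative `E(s) ∈ H.reps`;
* the parametrisation of every datum is `Aut(ℂ)`-equivariant along such transports
  (`ModularForms.ModularParametrizationData.isAutEquivariantOnHeegner`, the `ℚ`-rationality of `φ`),
  so `σ_s(φ(x(1))) = φ(τ_{E(s)})`, i.e. `s • y(1) ↦ φ(τ_{E(s)})` (`d.map_y`);
* `E` is injective: `E(s) = E(s')` forces `σ_s(j(x(1))) = j(τ_{E(s)}) = σ_{s'}(j(x(1)))`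
  (`LevelTransport.kleinJ_eq`), and `K[1] = ι(K)(j(x(1)))` (`eqOn_ringClassField_of_apply_kleinJ_eq`)
  gives `s = s'`;
* `E` is surjective by counting: `#H.reps = h_K` (`HeegnerDatum.card_reps_eq_classNumber_holds`,
  Gross 1984 §I.1) and `h_K = h(d_K) ≤ [K[1] : K] = #Aut_K(K[1]) ≤ #S`
  (`card_reducedForms_eq_classNumber`, `classNumber_le_finrank_ringClassField`,
  `IsGalois.card_aut_eq_finrank`, `σ ↦ σ.restrictScalars ℚ`).

Found by the ARM-P D-audit of the conductor-`1` Heegner statements (cell `pub/bsd-cited`, rows Q31 /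
r10 S4); sequel of `HeegnerPointsOfConductorOneRationalityProofs.lean` (Thm. 3.6 at conductor `1`) and
`HeegnerPointsOfConductorRationalityProofs.lean` (Gross §3 at conductor `n`).

## References

* [Darmon2004] H. Darmon, *Rational Points on Modular Elliptic Curves*, CBMS 101, AMS (2004),
  Thm. 3.7 (PDF p. 44), §3.7 (PDF p. 49).
* [GrossLMS1991] B. H. Gross, *Kolyvagin's work on modular elliptic curves*, LMS Lecture Note
  Ser. 153, CUP (1991), 235–256, §1 (pp. 235–236), §4 (p. 241, `P_1 = Tr y_1 = y_K`).
* [Gross1984] B. H. Gross, *Heegner points on `X₀(N)`*, in *Modular Forms* (Durham 1983), 1984, §I.1.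

## Mathlib / tree search

Tree, by name: `exists_levelTransport_of_apply_sqrtDisc_eq`, `LevelTransport.of_gamma0_smul_eq_right`
(`HeegnerPointsLevelTransport`), `LevelTransport.kleinJ_eq` (`HeckeNeighbourTransport`),
`apply_sqrtDisc_discr_eq`, `exists_perm_levelTransport` (`HeegnerPointsShimuraReduction`),
`ModularForms.ModularParametrizationData.isAutEquivariantOnHeegner` (`HeegnerPointsRationalityProofs`),
`KolyvaginHeegnerData.mem_S_iff` (`HeegnerPointsOfConductorOneData`), `eqOn_ringClassField_of_apply_kleinJ_eq`,
(`RingClassFieldGenerator`), `classNumber_le_finrank_ringClassField`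
(`RingClassFieldDegree`), `Quadratic.card_reducedForms_eq_classNumber` (`DedekindZetaReducedForms`),
`HeegnerDatum.card_reps_eq_classNumber_holds` (`HeegnerPointsClassNumberProofs`).
`rg 'heegnerPointOfConductor_one_galoisConj_holds'` over `lean/`: no prior discharge.
-/

noncomputable section

open scoped Classical Cardinal

universe u

namespace Literature.NumberTheory.EllipticCurves

open ModularForms Cardinal NumberField
open Literature.NumberTheory.QuadraticFields.BinaryQuadraticForm
open Literature.NumberTheory.QuadraticFields.Quadratic
open Literature.FieldTheory.AlgClosed

/-- `K[n]` is countable (`K[n]/K` finite for `n ≠ 0`; twin of the private helper of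
`RingClassFieldGenerator`). [folklore] -/
private theorem cardinalMk_ringClassField_le {K : Type u} [Field K] [NumberField K]
    (hK : IsImaginaryQuadratic K) (ι : K →+* ℂ) {n : ℕ} (hn : n ≠ 0) :
    #(ringClassField K ι n) ≤ ℵ₀ := by
  haveI := (finiteDimensional_and_isGalois_ringClassField hK ι hn).1
  haveI : FiniteDimensional ℚ (ringClassField K ι n) := Module.Finite.trans K (ringClassField K ι n)
  haveI : Algebra.IsAlgebraic ℚ (ringClassField K ι n) := Algebra.IsAlgebraic.of_finite ℚ _
  exact Subfield.cardinalMk_le_aleph0_of_isAlgebraic _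

/-! The parameters of the named fact (level, model, field); the discharge is the closed statement at
every `(N, W, K)` with `K : Type` — the universe of every consumer and of the generator theorem
`eqOn_ringClassField_of_apply_kleinJ_eq` (`RingClassFieldGenerator.lean` is written at `K : Type`; the
fact itself is stated at `K : Type u`, and the `Type u` instance awaits a universe-polymorphic
`RingClassFieldGenerator`). -/
variable (N : ℕ) [NeZero N] (W : WeierstrassCurve ℚ) (K : Type) [Field K] [NumberField K]

/-- **Darmon 2004, Thm. 3.7 / Gross 1991 §4 for `y(1)`, PROVED**: for a conductor-`1` Kolyvagin datum
`d` and a Heegner datum `H` of discriminant `d_K` with `H.β = β`, there is a bijection `e : d.S ≃ H.reps`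
with `s • y(1) ↦ φ(τ_{e s})` in `E(ℂ)` for every `s ∈ S = Gal(K[1]/K)` — the named fact
`heegnerPointOfConductor_one_galoisConj N W K`, discharged.
[cite: Darmon2004, Thm. 3.7 (PDF p. 44) and §3.7 (PDF p. 49)]
[cite: GrossLMS1991, §4 (P_1 = Tr y_1 = y_K) and §1 (pp. 235–236)] [cite: Gross1984, §I.1] -/
theorem heegnerPointOfConductor_one_galoisConj_holds :
    heegnerPointOfConductor_one_galoisConj N W K := by
  intro _ hK hH Dt β ι d H hHβ
  subst hHβ
  have hD : NumberField.discr K < 0 := hK.discr_neg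
  have hND : IsCoprime (N : ℤ) (NumberField.discr K) := by
    have h := Literature.SatisfiesHeegnerHypothesis.coprime_discr hK.1 hH
    refine Int.isCoprime_iff_gcd_eq_one.mpr ?_
    rw [Int.gcd_eq_natAbs, Int.natAbs_natCast]
    exact h
  -- `Q_1 = ((β² − d_K)/4, β, 1)`, the form of `x(1)`: a Heegner form of residue `β`
  obtain ⟨hQ1, hQ1β⟩ :=
    heegnerFormOfConductor_mem_heegnerForms (N := N) hD H.dvd_sq_sub (one_ne_zero (α := ℕ))
  simp only [Nat.cast_one, one_pow, one_mul] at hQ1 hQ1β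
  -- extend every `s ∈ S` to an automorphism `σ_s` of `ℂ`
  have hFc : #(ringClassField K ι 1) ≤ ℵ₀ := cardinalMk_ringClassField_le hK ι one_ne_zero
  have hext : ∀ s : d.S, ∃ σ : ℂ ≃+* ℂ, ∀ x : (ringClassField K ι 1), σ x = (((s : (ringClassField K ι 1) ≃ₐ[ℚ] (ringClassField K ι 1)) x : (ringClassField K ι 1)) : ℂ) := fun s ↦
    Complex.exists_ringEquiv_apply_eq_of_subfield (ringClassField K ι 1) hFc
      ((ringClassField K ι 1).subtype.comp (s : (ringClassField K ι 1) ≃ₐ[ℚ] (ringClassField K ι 1)).toRingEquiv.toRingHom)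
  choose σ hσ using hext
  have hσK : ∀ (s : d.S) (k : K), σ s (ι k) = ι k := by
    intro s k
    have hs : (s : (ringClassField K ι 1) ≃ₐ[ℚ] (ringClassField K ι 1)) ∈ ringClassGal ι 1 := (d.mem_S_iff _).mp s.2
    have hfix := smul_algebraMap_of_mem_ringClassGal hs k
    rw [← coe_algebraMap_ringClassField ι 1 k, hσ s, hfix]
  have hσD : ∀ s : d.S, σ s (sqrtDisc (NumberField.discr K)) = sqrtDisc (NumberField.discr K) :=
    fun s ↦ apply_sqrtDisc_discr_eq hK ι (hσK s)
  -- transport `x(1)` by `σ_s` onto a representative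
  have key : ∀ s : d.S, ∃ r : H.reps,
      LevelTransport N (σ s) (heegnerTau (heegnerFormOfConductor (NumberField.discr K) H.β 1))
        (heegnerTau (r : ℤ × ℤ × ℤ)) := by
    intro s
    obtain ⟨Q', hQ', hβ', hT⟩ :=
      exists_levelTransport_of_apply_sqrtDisc_eq hK hND H.dvd_sq_sub (hσD s) hQ1 hQ1β
    obtain ⟨r, hr, γ, hγ⟩ := H.exists_isGamma0Equiv Q' hQ' hβ'
    refine ⟨⟨r, hr⟩, hT.of_gamma0_smul_eq_right (γ := γ) ?_⟩
    rw [← hγ, Subgroup.smul_def]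
  choose E hE using key
  -- the parametrisation is `Aut(ℂ)`-equivariant along the transport
  have hφ : Dt.IsAutEquivariantOnHeegner (NumberField.discr K) := Dt.isAutEquivariantOnHeegner _
  have hval : ∀ s : d.S,
      WeierstrassCurve.Affine.Point.map (ringClassField K ι 1).subtype.toRatAlgHom
          (pointGalHom W (ringClassField K ι 1) (s : _ ≃ₐ[ℚ] _) d.y) =
        Dt.φ (heegnerTau ((E s : ℤ × ℤ × ℤ))) := by
    intro s
    have hy : WeierstrassCurve.Affine.Point.map (ringClassField K ι 1).subtype.toRatAlgHom d.y =
        Dt.φ (heegnerTau (heegnerFormOfConductor (NumberField.discr K) H.β 1)) := by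
      simpa only [heegnerPointComplexOfConductor, heegnerPointOfConductor] using d.map_y
    calc WeierstrassCurve.Affine.Point.map (ringClassField K ι 1).subtype.toRatAlgHom
            (pointGalHom W (ringClassField K ι 1) (s : _ ≃ₐ[ℚ] _) d.y)
        = WeierstrassCurve.Affine.Point.map ((σ s : ℂ →+* ℂ)).toRatAlgHom
            (WeierstrassCurve.Affine.Point.map (ringClassField K ι 1).subtype.toRatAlgHom d.y) := by
          rw [pointGalHom_apply, WeierstrassCurve.Affine.Point.map_map,
            WeierstrassCurve.Affine.Point.map_map]
          exact WeierstrassCurve.Affine.Point.map_congr_fun (fun x ↦ (hσ s x).symm) _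
      _ = Dt.φ (heegnerTau ((E s : ℤ × ℤ × ℤ))) := by
          rw [hy]
          exact hφ (σ s) (hσD s) hQ1 (H.mem_heegnerForms _ (E s).2).1 (hE s)
  -- `E` is injective: `K[1] = ι(K)(j(x(1)))`
  have hinj : Function.Injective E := by
    intro s s' hss'
    have h1 := (hE s).kleinJ_eq
    have h2 := (hE s').kleinJ_eq
    rw [hss'] at h1
    have hj : σ s (kleinJ (heegnerPointOfConductor (NumberField.discr K) H.β 1)) =
        σ s' (kleinJ (heegnerPointOfConductor (NumberField.discr K) H.β 1)) :=
      h1.symm.trans h2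
    have hKφψ : ∀ k : K, (σ s).toRingHom (ι k) = (σ s').toRingHom (ι k) := fun k ↦ by
      rw [RingEquiv.toRingHom_eq_coe, RingEquiv.coe_toRingHom, RingEquiv.toRingHom_eq_coe,
        RingEquiv.coe_toRingHom, hσK s k, hσK s' k]
    have hj' : (σ s).toRingHom (kleinJ (heegnerPointOfConductor (NumberField.discr K) H.β 1)) =
        (σ s').toRingHom (kleinJ (heegnerPointOfConductor (NumberField.discr K) H.β 1)) := by
      rw [RingEquiv.toRingHom_eq_coe, RingEquiv.coe_toRingHom, RingEquiv.toRingHom_eq_coe,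
        RingEquiv.coe_toRingHom]
      exact hj
    have heq := eqOn_ringClassField_of_apply_kleinJ_eq (N := N) (β := H.β) (n := 1)
      (φ := (σ s).toRingHom) (ψ := (σ s').toRingHom) hK ι H.dvd_sq_sub one_ne_zero hKφψ hj'
    apply Subtype.ext
    ext x
    have hx : σ s x = σ s' x := by
      have := heq x.2
      rwa [RingEquiv.toRingHom_eq_coe, RingEquiv.coe_toRingHom, RingEquiv.toRingHom_eq_coe,
        RingEquiv.coe_toRingHom] at this
    rw [hσ s x, hσ s' x] at hx
    rw [Subtype.ext hx]
  -- `E` is surjective by counting: `#H.reps = h_K ≤ [K[1] : K] = #Aut_K(K[1]) ≤ #S`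
  haveI := (finiteDimensional_and_isGalois_ringClassField hK ι one_ne_zero).1
  haveI := (finiteDimensional_and_isGalois_ringClassField hK ι one_ne_zero).2
  have hreps : Fintype.card H.reps = NumberField.classNumber K := by
    rw [Fintype.card_coe]
    exact HeegnerDatum.card_reps_eq_classNumber_holds N K hK hH H
  let f : ((ringClassField K ι 1) ≃ₐ[K] (ringClassField K ι 1)) → d.S := fun τ ↦ ⟨τ.restrictScalars ℚ, (d.mem_S_iff _).mpr (by
      rw [ringClassGal, mem_fixingSubgroup_iff]
      rintro x ⟨k, hk⟩
      have hx : x = algebraMap K (ringClassField K ι 1) k := Subtype.ext hk.symm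
      rw [hx, AlgEquiv.smul_def, AlgEquiv.restrictScalars_apply]
      exact τ.commutes k)⟩
  have hf : Function.Injective f := fun τ τ' h ↦
    AlgEquiv.restrictScalars_injective ℚ (congrArg Subtype.val h)
  have hS : NumberField.classNumber K ≤ Fintype.card d.S := by
    have h1 : NumberField.classNumber K ≤ Module.finrank K (ringClassField K ι 1) := by
      rw [← card_reducedForms_eq_classNumber hK.1 hD]
      simpa using classNumber_le_finrank_ringClassField hK ι (n := 1) one_ne_zero
    have h2 : Module.finrank K (ringClassField K ι 1) = Nat.card ((ringClassField K ι 1) ≃ₐ[K] (ringClassField K ι 1)) := (IsGalois.card_aut_eq_finrank K (ringClassField K ι 1)).symm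
    have h3 : Nat.card ((ringClassField K ι 1) ≃ₐ[K] (ringClassField K ι 1)) ≤ Nat.card d.S := Nat.card_le_card_of_injective f hf
    simp only [Nat.card_eq_fintype_card] at h2 h3
    omega
  have hbij : Function.Bijective E :=
    (Fintype.bijective_iff_injective_and_card E).mpr
      ⟨hinj, le_antisymm (Fintype.card_le_of_injective E hinj) (hreps ▸ hS)⟩
  exact ⟨Equiv.ofBijective E hbij, fun s ↦ hval s⟩

end Literature.NumberTheory.EllipticCurves

end
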